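import Summits.BirchSwinnertonDyer.BirchSwinnertonDyer.Theorems.ManinLocalTwoThreeGenerationCocycle
import HarnessLib

/-!
# Route `ManinLocalTwoThree`, cruxes C2 (stmt-BirchSwinnertonDyer-22967) / C3 (stmt-BirchSwinnertonDyer-22968): the HECKE side of
# the functional cocycle `u_φ(γ) = φ({∞, γ∞}_f)` — it is an honest eigenvector of the cocycle Hecke operators `heckeU`
# (T-es-12 vocabulary) with eigenvalues `a_ℓ(W) mod p` (line prover p3; helper, unconditional)

* `periodFn_zero_eq_neg_mul_cuspSymbol` — in weight `2` the Eichler–Shimura period cocycle of the tree is the cusp symbol: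
  `periodFn 0 g γ q = −(i/2π)·{∞, γ∞}_g` for `γ ∈ Γ₀(N)`;
* `cuspSymbol_heckeT_eq_sum` — `{∞, γ∞}_{T_ℓ g} = Σᵢ {∞, γ'ᵢ∞}_g` over the tree's Hecke coset data `heckePermElt`
  (`periodFn_heckeT` read in weight `2`);
* `heckeU_functionalCocycle` — for a `W`-newform `f` and additive `φ : Λ_f → R`:
  `heckeU 0 N R hℓ u_φ = (a_ℓ(W) : R) • u_φ` for every prime `ℓ` (`T_ℓ f = a_ℓ f`, `a_ℓ = W.LFunction ℓ ∈ ℤ`);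
* `isHeckeGenEigenvector_functionalCocycle` — hence `u_φ` is a (generalised) Hecke eigenvector for the system
  `ℓ ↦ (W.LFunction ℓ : K)` away from ANY finite set `S` (`IsHeckeGenEigenvector`, T-es-12).
Together with `shiftClassGenerationThree_of_cocycles` / `multiShiftClassGenerationTwo_of_cocycles` this leaves, for the
consumption of a typed E-es-25, only the NON-EISENSTEIN property of `ℓ ↦ a_ℓ(W) mod p` for `W[p]` irreducible (a cited
Galois-representation fact).  Nothing about BSD, Manin's conjecture, E-es-19/22/25 is proved here.
-/

set_option autoImplicit false
set_option linter.dupNamespace false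

noncomputable section

open scoped Classical MatrixGroups ModularForm BigOperators

open CongruenceSubgroup Matrix.SpecialLinearGroup ModularGroup Complex
  Literature.NumberTheory.EllipticCurves Literature.NumberTheory.EllipticCurves.ModularForms
  Literature.NumberTheory.EllipticCurves.ModularForms.HidaCohomology
  Summit.BirchSwinnertonDyer.Rank1Residual.ManinAdditive

namespace Summit.BirchSwinnertonDyer.BirchSwinnertonDyer.Theorems.ManinLocalTwoThree

section HeckeSide

variable {N : ℕ} [NeZero N]

/-- **Weight 2: the period cocycle is the cusp symbol**, `periodFn 0 g γ q = −(i/2π)·{∞, γ∞}_g` for `γ ∈ Γ₀(N)`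
(`c_g(γ) = ∫_i^{i∞} g − ∫_{γi}^{i∞} g`, `∫_τ^{i∞} g = (i/2π)·2π∫₀^∞ g(τ+it)dt`, and `{∞, γ∞}_g = V(γi) − V(i)`,
`eichlerIntegral_smul_sub_holds`). [cite: Shimura1971, §8.2 (8.2.20)] -/
theorem periodFn_zero_eq_neg_mul_cuspSymbol (g : CuspForm (Gamma0 N) 2) (γ : Gamma0 N) (q : Fin 2 → ℂ) :
    periodFn 0 g γ q = -(I / (2 * Real.pi)) * cuspSymbol g γ := by
  have h0 : periodFn 0 g γ q = eichlerPrimitive (⇑g ∣[(2 : ℤ)] (γ : SL(2, ℤ))) UpperHalfPlane.I -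
      eichlerPrimitive ⇑g ((γ : SL(2, ℤ)) • UpperHalfPlane.I) := by
    simp only [periodFn, eichlerKernel, Nat.cast_zero, zero_add, Finset.range_one, Finset.sum_singleton,
      Nat.choose_self, Nat.cast_one, one_mul, powPrimitive_zero, pow_zero, mul_one, Nat.sub_self]
    rfl
  rw [h0, slash_Gamma0, eichlerPrimitive_eq, eichlerPrimitive_eq, ← eichlerIntegral_smul_sub_holds g γ UpperHalfPlane.I]
  show I / (2 * Real.pi) * eichlerIntegral g UpperHalfPlane.I -
      I / (2 * Real.pi) * eichlerIntegral g ((γ : SL(2, ℤ)) • UpperHalfPlane.I) = _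
  ring

/-- **`{∞, γ∞}_{T_ℓ g} = Σᵢ {∞, γ'ᵢ∞}_g`** over the tree's Hecke coset data (`heckePermElt`): the weight-2 reading of
`periodFn_heckeT`. [cite: Shimura1971, §8.3 (8.3.2)] -/
theorem cuspSymbol_heckeT_eq_sum {ℓ : ℕ} [NeZero ℓ] (hℓ : ℓ.Prime) (g : CuspForm (Gamma0 N) 2) (γ : Gamma0 N) :
    cuspSymbol (heckeT (Gamma0 N) 2 ℓ g) γ = ∑ i : HeckeIdx N ℓ, cuspSymbol g (heckePermElt hℓ γ i) := by
  have h := periodFn_heckeT (n := 0) hℓ g γ 0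
  rw [periodFn_zero_eq_neg_mul_cuspSymbol] at h
  simp only [periodFn_zero_eq_neg_mul_cuspSymbol] at h
  rw [← Finset.mul_sum] at h
  have hc : -(I / (2 * Real.pi)) ≠ 0 := by
    have hπ : (2 * (Real.pi : ℂ)) ≠ 0 := by
      have : (Real.pi : ℂ) ≠ 0 := by exact_mod_cast Real.pi_ne_zero
      exact mul_ne_zero two_ne_zero this
    exact neg_ne_zero.mpr (div_ne_zero I_ne_zero hπ)
  exact mul_left_cancel₀ hc h

variable {R : Type*} [CommRing R]

/-- **The functional cocycle is a Hecke eigenvector**: for the newform `f` of `W` and additive `φ : Λ_f → R`,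
`T_ℓ u_φ = a_ℓ(W)·u_φ` on cocycles (`heckeU`), for every prime `ℓ` (`T_ℓ f = a_ℓ f`, `cuspSymbol_heckeT_eq_sum`).
[folklore] -/
theorem heckeU_functionalCocycle {W : WeierstrassCurve ℚ} {f : CuspForm (Gamma0 N) 2} (hf : IsNewformOf W f)
    (φ : ↥(periodLattice f) →+ R) {ℓ : ℕ} [NeZero ℓ] (hℓ : ℓ.Prime) :
    heckeU 0 N R hℓ (fun (γ : Gamma0 N) (_ : Fin 1) => φ ⟨cuspSymbol f γ, cuspSymbol_mem_periodLattice f γ⟩) =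
      ((W.LFunction ℓ : ℤ) : R) • (fun (γ : Gamma0 N) (_ : Fin 1) => φ ⟨cuspSymbol f γ, cuspSymbol_mem_periodLattice f γ⟩) := by
  funext γ i
  rw [heckeU_apply]
  simp only [act_zero_eq_id, LinearMap.id_apply, Finset.sum_apply, Pi.smul_apply]
  -- `Σᵢ φ({∞, γ'ᵢ∞}_f) = φ(Σᵢ {∞, γ'ᵢ∞}_f) = φ({∞, γ∞}_{T_ℓ f}) = φ(a_ℓ · {∞, γ∞}_f)`
  rw [← map_sum]
  have hT : heckeT (Gamma0 N) 2 ℓ f = ((W.LFunction ℓ : ℤ) : ℂ) • f := by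
    rw [hf.1.heckeT_eq_coeff_smul hℓ]
    exact congrArg (· • f) (hf.2 ℓ)
  have hsum : (∑ i : HeckeIdx N ℓ, (⟨cuspSymbol f (heckePermElt hℓ γ i), cuspSymbol_mem_periodLattice f _⟩ :
      ↥(periodLattice f))) = (W.LFunction ℓ : ℤ) • ⟨cuspSymbol f γ, cuspSymbol_mem_periodLattice f γ⟩ := by
    apply Subtype.ext
    rw [AddSubmonoidClass.coe_finsetSum, AddSubgroupClass.coe_zsmul]
    show ∑ i : HeckeIdx N ℓ, cuspSymbol f (heckePermElt hℓ γ i) = (W.LFunction ℓ : ℤ) • cuspSymbol f γ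
    rw [← cuspSymbol_heckeT_eq_sum hℓ f γ, hT, cuspSymbol_smul, zsmul_eq_mul]
  rw [hsum, map_zsmul, zsmul_eq_mul, smul_eq_mul]

/-- **`u_φ` is a (generalised) Hecke eigenvector for the system `ℓ ↦ a_ℓ(W)`** away from any finite set of primes `S`
(`IsHeckeGenEigenvector`, T-es-12 vocabulary; honest eigenvector by `heckeU_functionalCocycle`). [folklore] -/
theorem isHeckeGenEigenvector_functionalCocycle {K : Type*} [Field K] {W : WeierstrassCurve ℚ}
    {f : CuspForm (Gamma0 N) 2} (hf : IsNewformOf W f) (φ : ↥(periodLattice f) →+ K) (S : Finset ℕ) :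
    IsHeckeGenEigenvector S (fun ℓ => ((W.LFunction ℓ : ℤ) : K))
      ⟨fun (γ : Gamma0 N) (_ : Fin 1) => φ ⟨cuspSymbol f γ, cuspSymbol_mem_periodLattice f γ⟩,
        functionalCocycle_mem_cocycles f φ⟩ := by
  refine isHeckeGenEigenvector_of_eigenvector S _ _ fun ℓ _ hℓ _ => ?_
  apply Subtype.ext
  rw [coe_heckeUZ]
  exact heckeU_functionalCocycle hf φ hℓ

end HeckeSide

end Summit.BirchSwinnertonDyer.BirchSwinnertonDyer.Theorems.ManinLocalTwoThree

end
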